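import Summits.QuantumFields.YangMills.Theorems.UnitScaleTiltProp8FlatPortKernelRows
import HarnessLib

/-!
# Route `UnitScaleTilt`, crux K1 child «MinimiserStabilityRegPr» (stmt-QuantumFields-19200), v8 pillar **P2 `stub_flatOpsCubeSeq`** — THE PORT BRIDGE, file 10:
# **THE BODY OF THE REGISTERED P2 TEXT `FlatCubeOpsText.FlatOpsAdmAtMS` (the `∃ H G̃ … ∃ dBI …` clause) HOLDS AT EVERY ADMISSIBLE DATUM WITH `Ω₁ = T` ON TORI WITH
# `≥ 5L` BIG BLOCKS PER DIRECTION, EVERY ODD `L ≥ 5`** — file 9's `kernelRowsAt_of_adm22` through g16's `rowsAt_of_kernelRowsAt` + `body_of_rowsAt`; the multi-level twin of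
# g16's one-level `FlatRowsWholeClosed.body_whole`

Cell `ym3-torus` (HUMAN RULING D-0037, YM ladder rung R3), seat `ym3-torus-p1` gen 17.  `--supports stmt-QuantumFields-19200 --as helper`; count-neutral; def-free.

WHAT IS PROVED (sorry-free; axioms standard; no definition): **`rowsAt_of_adm22`** (the full row list `RowsAt`, `C_Q = L`) and **`body_of_adm22`** (the text's body: the canonical
`flatH`, `G̃ = gtOf G` pinned by `IsFlatH`/`IsFlatGt`, the guarded (46)/`hG`/Laplacian letters, and a distance `dBI ≥ distBI` with (162) and the four (161)₁ rows) — for every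
member `F = ⟨ℓ+1, hL, m, hm⟩` with `4 ≤ ℓ`, heights `1 ≤ K − n`, `K − n + 1 ≤ m + K`, big blocks `M = L·M_h`, `M_h = L^{a′} ≥ M_h⁰`, `R ≥ R₀`, `a′ + 3 ≤ m + n`, every
`D : Domains (F.P K)` with `D.k = K − n`, `Adm22 D R (L·M_h)`, `D.Om 1 = univ`, and every level-weight family.
HONEST SCOPE: what separates this from the registered `stub_flatOpsCubeSeq` is EXACTLY (P2-L0) families with a level-0 region (lit-balaban's `…L0` port, landing), (P2-L3) `L = 3`,
(P2-small) tori below `5L` big blocks (UV3-NODE §26.3).  NOT a claim about the mass gap.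

References: T. Bałaban, CMP **102** (1985) 277–309 [Balaban1985Variational] (46) p.285, (130) p.298, (157)–(158) p.302, (161)–(163) p.303, (165) p.304; CMP **96** (1984) 223–250
[Balaban1984PropagatorsII] (2.1)–(2.2) p.224, Prop. 2.6 (2.136) p.247, Cor. 2.8 (2.150)–(2.151) p.249.
-/

set_option autoImplicit false

noncomputable section

namespace Summit.QuantumFields.YangMills.Theorems.FlatPortBody

open Literature.MathematicalPhysics.QuantumFieldTheory.Balaban1983to89
open B6GlobalChartV1 (PV)
open B6SectADomainsV1 (Domains)
open B6SectAOperatorsV1 (BondIdx)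
open T3ContinuumYM3Torus (T3Family)
open FlatCubeOpsText (Adm22 IsLevWeight distBI IsFlatH IsFlatGt HSupLetterG GtSupLetterG GtLaplaceLetterG HDecayLetterD RowSum162)
open FlatOpsLettersAssembly (RowsAt body_of_rowsAt levWeight_nonneg)
open FlatOpsFromKernelRows (rowsAt_of_kernelRowsAt)
open FlatPortKernelRows (kernelRowsAt_of_adm22)

/-- `1 ≤ 3` (named once). [folklore] -/
private theorem hd3 : 1 ≤ 2 + 1 := by norm_num

/-- **THE FULL ROW LIST `RowsAt` AT EVERY ADMISSIBLE DATUM WITH `Ω₁ = T`** (tori with `≥ 5L` big blocks per direction, odd `L ≥ 5`), `C_Q = L`.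
[cite: Balaban1984PropagatorsII, (2.1)-(2.2) p.224, Prop. 2.6 (2.136) p.247, Cor. 2.8 (2.150)-(2.151) p.249; Balaban1985Variational, (46) p.285, (130) p.298, (161)-(163) p.303] -/
theorem rowsAt_of_adm22 (ℓ : ℕ) (hL : Odd (ℓ + 1) ∧ 1 < ℓ + 1) (hℓ : 4 ≤ ℓ) (m : ℕ) (hm : 1 ≤ m) :
    ∃ (Mh₀ R₀ : ℕ) (C δ₀ B₃ CG : ℝ), 0 ≤ C ∧ 0 < δ₀ ∧ 0 < B₃ ∧ 0 ≤ CG ∧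
    ∀ (n K : ℕ) (_ : 1 ≤ K - n) (_ : K - n + 1 ≤ m + K) {Mh R a' : ℕ} (_ : Mh = (ℓ + 1) ^ a') (_ : Mh₀ ≤ Mh) (_ : R₀ ≤ R) (_ : a' + 3 ≤ m + n)
      (D : Domains (PV 2 ℓ m K hd3 hL)) (_ : D.k = K - n) (_ : D.Om 1 = Finset.univ) (_ : Adm22 D R ((ℓ + 1) * Mh))
      (w : ℕ → PBond (PV 2 ℓ m K hd3 hL) 0 → ℝ) (_ : IsLevWeight (⟨ℓ + 1, hL, m, hm⟩ : T3Family) n K D w),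
      RowsAt (⟨ℓ + 1, hL, m, hm⟩ : T3Family) n K D w (max C (C * B₃)) δ₀ B₃ CG (((ℓ + 1 : ℕ) : ℝ)) := by
  obtain ⟨Mh₀, R₀, C, δ₀, B₃, CG, hC, hδ₀, hB₃, hCG, hmain⟩ := kernelRowsAt_of_adm22 ℓ hL hℓ m hm
  refine ⟨max Mh₀ 2, max R₀ 1, C, δ₀, B₃, CG, hC, hδ₀, hB₃, hCG, ?_⟩
  intro n K hk1 hk' Mh R a' hMha hMh hR hsize D hDk h1 hAdm w hw
  have hKR := hmain n K hk1 hk' hMha (le_trans (le_max_left _ _) hMh) (le_trans (le_max_left _ _) hR) hsize D hDk h1 hAdm w hw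
  have hRM : 2 * ((⟨ℓ + 1, hL, m, hm⟩ : T3Family)).L ≤ R * ((ℓ + 1) * Mh) := by
    show 2 * (ℓ + 1) ≤ R * ((ℓ + 1) * Mh)
    have hR1 : 1 ≤ R := le_trans (le_max_right _ _) hR
    have hM2 : 2 ≤ Mh := le_trans (le_max_right _ _) hMh
    calc 2 * (ℓ + 1) = 1 * ((ℓ + 1) * 2) := by ring
      _ ≤ R * ((ℓ + 1) * Mh) := Nat.mul_le_mul hR1 (Nat.mul_le_mul_left _ hM2)
  exact rowsAt_of_kernelRowsAt hw hDk hAdm hRM hC hδ₀.le hKR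

/-- **THE BODY OF THE REGISTERED P2 TEXT AT EVERY ADMISSIBLE DATUM WITH `Ω₁ = T`** (tori with `≥ 5L` big blocks per direction, odd `L ≥ 5`): the canonical `H`, `G̃`
(pinned), the guarded (46)/`hG`/Laplacian letters at one constant `B₀(L)`, and a distance `dBI ≥ distBI` carrying (162) and the four (161)₁ rows at rate `δ₀(L)`.
[cite: Balaban1985Variational, (46) p.285, (130) p.298, (157)-(158) p.302, (161)-(163) p.303, (165) p.304; Balaban1984PropagatorsII, Prop. 2.6 (2.136) p.247, Cor. 2.8 p.249] -/
theorem body_of_adm22 (ℓ : ℕ) (hL : Odd (ℓ + 1) ∧ 1 < ℓ + 1) (hℓ : 4 ≤ ℓ) (m : ℕ) (hm : 1 ≤ m) :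
    ∃ (Mh₀ R₀ : ℕ) (B₀ δ₀ B₃ : ℝ), 0 < δ₀ ∧ 0 < B₃ ∧
    ∀ (n K : ℕ) (_ : 1 ≤ K - n) (_ : K - n + 1 ≤ m + K) {Mh R a' : ℕ} (_ : Mh = (ℓ + 1) ^ a') (_ : Mh₀ ≤ Mh) (_ : R₀ ≤ R) (_ : a' + 3 ≤ m + n)
      (D : Domains (PV 2 ℓ m K hd3 hL)) (_ : D.k = K - n) (_ : D.Om 1 = Finset.univ) (_ : Adm22 D R ((ℓ + 1) * Mh))
      (w : ℕ → PBond (PV 2 ℓ m K hd3 hL) 0 → ℝ) (_ : IsLevWeight (⟨ℓ + 1, hL, m, hm⟩ : T3Family) n K D w),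
      ∃ (H : (BondIdx D → ℝ) →ₗ[ℝ] (PBond (PV 2 ℓ m K hd3 hL) 0 → ℝ)) (Gt : (PBond (PV 2 ℓ m K hd3 hL) 0 → ℝ) →ₗ[ℝ] (PBond (PV 2 ℓ m K hd3 hL) 0 → ℝ)),
        IsFlatH (⟨ℓ + 1, hL, m, hm⟩ : T3Family) n K D H ∧ IsFlatGt (⟨ℓ + 1, hL, m, hm⟩ : T3Family) n K D Gt ∧
        HSupLetterG (⟨ℓ + 1, hL, m, hm⟩ : T3Family) n K D w H B₀ ∧ GtSupLetterG (⟨ℓ + 1, hL, m, hm⟩ : T3Family) n K w Gt B₀ ∧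
          GtLaplaceLetterG (⟨ℓ + 1, hL, m, hm⟩ : T3Family) n K w Gt B₀ ∧
        ∃ dBI : PBond (PV 2 ℓ m K hd3 hL) 0 → BondIdx D → ℝ,
          (∀ b c, distBI D b c ≤ dBI b c) ∧ RowSum162 (⟨ℓ + 1, hL, m, hm⟩ : T3Family) n K D dBI w δ₀ B₃ ∧
            HDecayLetterD (⟨ℓ + 1, hL, m, hm⟩ : T3Family) n K D dBI w H B₀ δ₀ := by
  obtain ⟨Mh₀, R₀, C, δ₀, B₃, CG, hC, hδ₀, hB₃, hCG, hmain⟩ := rowsAt_of_adm22 ℓ hL hℓ m hm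
  refine ⟨Mh₀, R₀, max (max C (C * B₃)) (CG + max C (C * B₃) * (((ℓ + 1 : ℕ) : ℝ)) * CG), δ₀, B₃, hδ₀, hB₃, ?_⟩
  intro n K hk1 hk' Mh R a' hMha hMh hR hsize D hDk h1 hAdm w hw
  exact body_of_rowsAt (levWeight_nonneg hw) hCG (Nat.cast_nonneg _) (hmain n K hk1 hk' hMha hMh hR hsize D hDk h1 hAdm w hw)

end Summit.QuantumFields.YangMills.Theorems.FlatPortBody

end
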